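import Summits.BirchSwinnertonDyer.BirchSwinnertonDyer.Theorems.EisensteinPrimesX1AnalyticLambdaCalculus
import Summits.BirchSwinnertonDyer.Rank1Residual.X2.LambdaParity
import Summits.BirchSwinnertonDyer.Rank1Residual.X2.RankZeroExact
import Literature.Barriers.BirchSwinnertonDyer.EisensteinMuConjecture
import HarnessLib

/-!
# Route `EisensteinPrimes`, line `mudescent`, stub `stub_lambdaCount_offLocus` (cruxes 3 / 5):
# the registered λ-count is EQUIVALENT to its PARITY-SLACK form `λ_an ≤ λ_alg + e + 1`
# (helper file; closes nothing)

Seat `bsd-eis-lam-a` g2 (PROGRAMME PART 1b, ACCEL-LIST (4), ANALYTIC side), items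
stmt-BirchSwinnertonDyer-19033 = crux 3 `MazurMCOnCellB` (X2 currency: odd multiplicative
Eisenstein prime, `r_an = 0`, type A) and -19035 = crux 5 `MazurMCOnX1RankZero` (X1 currency: good
anomalous Eisenstein prime, `r_an = 0`, type A); skeleton owner bsd-eis-ky (`Lines/mudescent.lean`).
Predecessor files (g0): `EisensteinPrimesAnalyticLambdaCalculus` (the analytic conjunct
`AnalyticLambdaEq W p n` is inhabited for every pair and is a class invariant),
`EisensteinPrimesAnalyticLambdaCruxSized` / `EisensteinPrimesX1AnalyticLambdaCalculus` (given
`μ_an = 0`, the stub at a pair IS Mazur's main conjecture at the pair).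

HONEST FRAMING (cell `bsd-eis`, programme §HONESTY: no tranche here proves BSD). THEOREMS ONLY — no
definition, no new named fact, nothing asserted about any curve, closes nothing. The class-wide
content of stub 4 on a ¬GVPar row (the inequality `λ(X(W₀/ℚ_∞)) ≥ λ_an(W₀,p) − e`) stays OPEN
(Greenberg–Vatsal 2000 p. 5; lam-a CENSUS §2–§4, lam-b MEMO-1 §3).

WHAT THIS FILE PROVES. The registered stub asks, at the étale end `W₀`, for `n k` with
`λ_an = n`, `λ_alg ≥ k` and `n ≤ k + e` (`e = 1` at a split multiplicative `p`, else `0`). HALF of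
every unit of λ-excess is already an analytic THEOREM of the tree: the Mazur–Tate–Teitelbaum
functional equation gives `λ_an ≡ r_an + e (mod 2)` (`X2.LambdaParity.analyticLambdaEq_parity` at
`p ‖ N`, `X1.ParitySqueeze.Leaf.even_of_analyticLambdaEq` at good ordinary `p`), and Greenberg's
Prop. 3.10 (`λ(X) ≡ corank Sel_{p^∞}(E/ℚ) (mod 2)`, PUBLISHED, cite-only named fact
`Greenberg1999.prop310_selmerCorank_mod_two_eq_lambdaInvariant`) gives the algebraic parity. Hence,
granted Wuthrich 2014 Thm. 16, Prop. 3.10, Gross–Zagier–Kolyvagin and modularity, AT A PAIR WITH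
`μ_an = 0` (stub 3 of the line):

  registered conclusion `∃ n k, λ_an = n ∧ λ_alg ≥ k ∧ n ≤ k + e`
    ⟺ slack conclusion `∃ n k, λ_an = n ∧ λ_alg ≥ k ∧ n ≤ k + e + 1`
    ⟺ Mazur's main conjecture at the pair

(`X2.lambdaCountSlack_iff_lambdaCount`, `X2.lambdaCountSlack_iff_mazurMainConjectureAt`,
`X2.cellB_lambdaCountSlack_iff`; X1 twins `X1.lambdaCountSlack_iff_lambdaCount`,
`X1.lambdaCountSlack_iff_mazurMainConjecture`), and AT THE LEVEL OF THE REGISTERED STUB SIGNATURES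
(`X2.stub_lambdaCount_iff_slack_of_stub_mu`, `X1.stub_lambdaCount_iff_slack_of_stub_mu`): given stub 3,
stub 4 as registered and stub 4 in slack form are INTERCHANGEABLE — reshaping the stub to the slack
form is lossless and costs the composition exactly one more PUBLISHED input (Prop. 3.10, not a
conjunct of `EisensteinPrimes.PublishedInputs`).

WHY IT MATTERS (numbers, not adjectives). Per pair the `AlgebraicLambdaGE` witness (Greenberg's
Cor. 5.6 Tamagawa budget, lam-b g2 `EisensteinPrimesAlgebraicLambdaGEBudget`) needs ONE forced zero
fewer: the pair of record of ky MEMO-4-K5 §3, `103206a1 @ 3` (split, `(μ, λ)_an = (0, 5)`, registered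
need `λ_alg ≥ 4`, Tamagawa desk bound `3` forced zeros of `char X`), has deficit `1` against the
registered form and deficit `0` against the slack form. Class-wide the residue of stub 4 is therefore
`λ_an ≤ λ_alg + e + 1`, not `λ_an ≤ λ_alg + e`.

References: [MazurTateTeitelbaum1986Invent] §I.17–I.18; [GreenbergLNM1716] Prop. 3.10, Cor. 5.6
(p. 136), §5 p. 183 (Conductor 147, p = 13: the parity squeeze); [Wuthrich2014] Thm. 16;
[GreenbergVatsal2000] p. 4–5; HOME/bsd-eis-ky-MEMO-4-K5.md §3; HOME/lam-a-g0/lam-a-CENSUS.md §4.3.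
-/

set_option linter.dupNamespace false
set_option autoImplicit false

noncomputable section

open scoped Classical MatrixGroups ModularForm

open PowerSeries CongruenceSubgroup WeierstrassCurve Literature.NumberTheory.EllipticCurves
  Literature.NumberTheory.EllipticCurves.ModularForms
  Literature.NumberTheory.EllipticCurves.Rank1Residual
  Literature.NumberTheory.EllipticCurves.Wuthrich2014
  Literature.NumberTheory.EllipticCurves.Greenberg1999
  Summit.BirchSwinnertonDyer.BirchSwinnertonDyer.Theorems.Rank1ResidualX1Defs
  Summit.BirchSwinnertonDyer.Rank1Residual
  Summit.BirchSwinnertonDyer.Rank1Residual.X1.MuLambda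
  Summit.BirchSwinnertonDyer.Rank1Residual.X1.MuPart
  Summit.BirchSwinnertonDyer.Rank1Residual.X1.ParitySqueeze
  Summit.BirchSwinnertonDyer.Rank1Residual.X1.TamagawaSqueeze
  Summit.BirchSwinnertonDyer.BirchSwinnertonDyer.Theorems.EisensteinPrimesAnalyticLambdaCruxSized
  Summit.BirchSwinnertonDyer.BirchSwinnertonDyer.Theorems.EisensteinPrimesX1AnalyticLambdaCalculus

open Literature.Barriers.BirchSwinnertonDyer (HasRamifiedOddLineAt)

namespace Summit.BirchSwinnertonDyer.BirchSwinnertonDyer.Theorems.EisensteinPrimesLambdaCountParitySlack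

variable {W : WeierstrassCurve ℚ} [W.IsElliptic] [W.IsGloballyMinimal] {p : ℕ} [Fact p.Prime]

/-! ## §1. X2 currency (crux 3, `p ‖ N` odd, `E[p]` reducible, `r_an ≤ 1`) -/

/-- **The slack λ-count at an X2 pair implies Mazur's main conjecture at the pair.** `W/ℚ` globally
minimal elliptic, `p ≠ 2` multiplicative with `E[p]` reducible, `r_an ≤ 1`, `μ_an = 0`
(`X2.AnalyticMuLE W p 0`). If `∃ n k, λ_an = n ∧ λ_alg ≥ k ∧ n ≤ k + 1 (non-split) / n ≤ k + 2 (split)`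
then `X2.MazurMainConjectureAt W p`: the tree's route T with parity discharged
(`X2.mazurMainConjectureAt_of_algebraicLambdaGE_of_le`: `λ_an ≡ r_an + e (mod 2)` from the
Mazur–Tate–Teitelbaum functional equation, `λ(X) ≡ r_an (mod 2)` from Prop. 3.10 + GZK), packaged
for an existential datum. PUBLISHED inputs by name: Wuthrich Thm. 16 (`hWu`), Greenberg Prop. 3.10
(`h310`), Gross–Zagier–Kolyvagin (`hGZK`), modularity (`hpar`).
[cite: GreenbergLNM1716, Prop. 3.10 and §5 p. 183] [cite: MazurTateTeitelbaum1986Invent, §I.17–I.18]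
[cite: Wuthrich2014, Thm. 16 (p. 397)] -/
theorem X2.mazurMainConjectureAt_of_lambdaCountSlack
    (hWu : thm16_charIdeal_dvd_multiplicative_of_reducible)
    (h310 : prop310_selmerCorank_mod_two_eq_lambdaInvariant)
    (hGZK : rank_eq_analyticRank_of_analyticRank_le_one)
    (hpar : nonempty_modularParametrizationData) (hp2 : p ≠ 2)
    (hmult : W.HasMultiplicativeReductionAtPrime p) (hred : ¬ W.HasIrreducibleModPGaloisRep p)
    (hr : W.analyticRank ≤ 1) (hμ0 : X2.AnalyticMuLE W p 0)
    (h : ∃ n k : ℕ, X2.AnalyticLambdaEq W p n ∧ AlgebraicLambdaGE W p k ∧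
      (¬ W.HasSplitMultiplicativeReductionAtPrime p → n ≤ k + 1) ∧
      (W.HasSplitMultiplicativeReductionAtPrime p → n ≤ k + 2)) :
    X2.MazurMainConjectureAt W p := by
  obtain ⟨n, k, hlam, halg, hkN, hkS⟩ := h
  exact X2.mazurMainConjectureAt_of_algebraicLambdaGE_of_le hWu h310 hGZK hpar W p hp2 hmult hred hr
    hμ0 hlam halg hkN hkS

/-- **Slack form ⟺ Mazur's main conjecture, at an X2 pair with `μ_an = 0`.** As
`X2.mazurMainConjectureAt_of_lambdaCountSlack`; conversely Mazur's main conjecture gives the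
REGISTERED conclusion with `n = k + e` (g0's `exists_lambdaCount_of_mazurMainConjectureAt`), a
fortiori the slack one. [cite: GreenbergLNM1716, Prop. 3.10] [cite: Wuthrich2014, Thm. 16 (p. 397)] -/
theorem X2.lambdaCountSlack_iff_mazurMainConjectureAt
    (hWu : thm16_charIdeal_dvd_multiplicative_of_reducible)
    (h310 : prop310_selmerCorank_mod_two_eq_lambdaInvariant)
    (hGZK : rank_eq_analyticRank_of_analyticRank_le_one)
    (hpar : nonempty_modularParametrizationData) (hp2 : p ≠ 2)
    (hmult : W.HasMultiplicativeReductionAtPrime p) (hred : ¬ W.HasIrreducibleModPGaloisRep p)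
    (hr : W.analyticRank ≤ 1) (hμ0 : X2.AnalyticMuLE W p 0) :
    (∃ n k : ℕ, X2.AnalyticLambdaEq W p n ∧ AlgebraicLambdaGE W p k ∧
      (¬ W.HasSplitMultiplicativeReductionAtPrime p → n ≤ k + 1) ∧
      (W.HasSplitMultiplicativeReductionAtPrime p → n ≤ k + 2)) ↔ X2.MazurMainConjectureAt W p := by
  refine ⟨X2.mazurMainConjectureAt_of_lambdaCountSlack hWu h310 hGZK hpar hp2 hmult hred hr hμ0,
    fun hMC ↦ ?_⟩
  obtain ⟨n, k, hlam, halg, hkN, hkS⟩ := exists_lambdaCount_of_mazurMainConjectureAt hpar hmult hμ0 hMC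
  exact ⟨n, k, hlam, halg, fun hns ↦ (hkN hns).trans (Nat.le_succ k), fun hs ↦ (hkS hs).trans (by omega)⟩

/-- **The registered λ-count ⟺ its parity-slack form, at an X2 pair with `μ_an = 0`** (`r_an ≤ 1`,
`p ≠ 2` multiplicative, `E[p]` reducible; PUBLISHED inputs `hWu`, `h310`, `hGZK`, `hpar`):
`(∃ n k, λ_an = n ∧ λ_alg ≥ k ∧ n ≤ k + e + 1) ↔ (∃ n k, λ_an = n ∧ λ_alg ≥ k ∧ n ≤ k + e)`.
Both sides are equivalent to `X2.MazurMainConjectureAt W p` (this file and g0's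
`lambdaCount_iff_mazurMainConjectureAt`). Consequence per pair: the algebraic witness may fall ONE
short of `λ_an − e` (the pair of record `103206a1 @ 3`: `λ_an = 5`, split, Tamagawa budget `3`).
[cite: GreenbergLNM1716, Prop. 3.10, Cor. 5.6 (p. 136) and §5 p. 183] [cite: Wuthrich2014, Thm. 16 (p. 397)] -/
theorem X2.lambdaCountSlack_iff_lambdaCount
    (hWu : thm16_charIdeal_dvd_multiplicative_of_reducible)
    (h310 : prop310_selmerCorank_mod_two_eq_lambdaInvariant)
    (hGZK : rank_eq_analyticRank_of_analyticRank_le_one)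
    (hpar : nonempty_modularParametrizationData) (hp2 : p ≠ 2)
    (hmult : W.HasMultiplicativeReductionAtPrime p) (hred : ¬ W.HasIrreducibleModPGaloisRep p)
    (hr : W.analyticRank ≤ 1) (hμ0 : X2.AnalyticMuLE W p 0) :
    (∃ n k : ℕ, X2.AnalyticLambdaEq W p n ∧ AlgebraicLambdaGE W p k ∧
      (¬ W.HasSplitMultiplicativeReductionAtPrime p → n ≤ k + 1) ∧
      (W.HasSplitMultiplicativeReductionAtPrime p → n ≤ k + 2)) ↔
    (∃ n k : ℕ, X2.AnalyticLambdaEq W p n ∧ AlgebraicLambdaGE W p k ∧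
      (¬ W.HasSplitMultiplicativeReductionAtPrime p → n ≤ k) ∧
      (W.HasSplitMultiplicativeReductionAtPrime p → n ≤ k + 1)) := by
  rw [X2.lambdaCountSlack_iff_mazurMainConjectureAt hWu h310 hGZK hpar hp2 hmult hred hr hμ0,
    lambdaCount_iff_mazurMainConjectureAt hWu hpar hp2 hmult hred hμ0]

/-- **On sub-cell X2b (`X2.CellB W p`: `r_an = 0`, `p ≠ 2` multiplicative, `E[p]` reducible, ¬GVPar)
with `μ_an = 0`, the registered conclusion of `stub_lambdaCount_offLocus` and its slack form are
equivalent.** The crux-3 reading of `X2.lambdaCountSlack_iff_lambdaCount`.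
[cite: GreenbergLNM1716, Prop. 3.10] [cite: Wuthrich2014, Thm. 16 (p. 397)] -/
theorem X2.cellB_lambdaCountSlack_iff
    (hWu : thm16_charIdeal_dvd_multiplicative_of_reducible)
    (h310 : prop310_selmerCorank_mod_two_eq_lambdaInvariant)
    (hGZK : rank_eq_analyticRank_of_analyticRank_le_one)
    (hpar : nonempty_modularParametrizationData) (hc : X2.CellB W p) (hμ0 : X2.AnalyticMuLE W p 0) :
    (∃ n k : ℕ, X2.AnalyticLambdaEq W p n ∧ AlgebraicLambdaGE W p k ∧
      (¬ W.HasSplitMultiplicativeReductionAtPrime p → n ≤ k + 1) ∧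
      (W.HasSplitMultiplicativeReductionAtPrime p → n ≤ k + 2)) ↔
    (∃ n k : ℕ, X2.AnalyticLambdaEq W p n ∧ AlgebraicLambdaGE W p k ∧
      (¬ W.HasSplitMultiplicativeReductionAtPrime p → n ≤ k) ∧
      (W.HasSplitMultiplicativeReductionAtPrime p → n ≤ k + 1)) :=
  X2.lambdaCountSlack_iff_lambdaCount hWu h310 hGZK hpar hc.2.1.1 hc.2.1.2.2 hc.2.1.2.1
    (by rw [hc.1]; exact Nat.zero_le 1) hμ0

/-- **At the level of the registered stub signatures of `Lines/mudescent.lean` on crux 3: given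
stub 3 (`μ_an = 0` off the locus), stub 4 AS REGISTERED and stub 4 IN SLACK FORM are interchangeable.**
Both universally quantified statements range over the X2b pairs off the `EisensteinMuBarrier` locus
(`¬ HasRamifiedOddLineAt W₀ p`); the equivalence is pointwise (`X2.cellB_lambdaCountSlack_iff`). For
the OWNER: reshaping stub 4 to the slack form is lossless and adds exactly Greenberg's Prop. 3.10
(`h310`, PUBLISHED, cite-only; not a conjunct of `EisensteinPrimes.PublishedInputs`) to the
composition's displayed inputs. [cite: GreenbergLNM1716, Prop. 3.10 and §5 p. 183]
[cite: Wuthrich2014, Thm. 16 (p. 397)] -/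
theorem X2.stub_lambdaCount_iff_slack_of_stub_mu
    (hWu : thm16_charIdeal_dvd_multiplicative_of_reducible)
    (h310 : prop310_selmerCorank_mod_two_eq_lambdaInvariant)
    (hGZK : rank_eq_analyticRank_of_analyticRank_le_one)
    (hpar : nonempty_modularParametrizationData)
    (hμ : ∀ (W₀ : WeierstrassCurve ℚ) [W₀.IsElliptic] [W₀.IsGloballyMinimal] (p : ℕ) [Fact p.Prime],
      X2.CellB W₀ p → ¬ HasRamifiedOddLineAt W₀ p → X2.AnalyticMuLE W₀ p 0) :
    (∀ (W₀ : WeierstrassCurve ℚ) [W₀.IsElliptic] [W₀.IsGloballyMinimal] (p : ℕ) [Fact p.Prime],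
      X2.CellB W₀ p → ¬ HasRamifiedOddLineAt W₀ p →
        ∃ n k : ℕ, X2.AnalyticLambdaEq W₀ p n ∧ AlgebraicLambdaGE W₀ p k ∧
          (¬ W₀.HasSplitMultiplicativeReductionAtPrime p → n ≤ k) ∧
          (W₀.HasSplitMultiplicativeReductionAtPrime p → n ≤ k + 1)) ↔
    (∀ (W₀ : WeierstrassCurve ℚ) [W₀.IsElliptic] [W₀.IsGloballyMinimal] (p : ℕ) [Fact p.Prime],
      X2.CellB W₀ p → ¬ HasRamifiedOddLineAt W₀ p →
        ∃ n k : ℕ, X2.AnalyticLambdaEq W₀ p n ∧ AlgebraicLambdaGE W₀ p k ∧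
          (¬ W₀.HasSplitMultiplicativeReductionAtPrime p → n ≤ k + 1) ∧
          (W₀.HasSplitMultiplicativeReductionAtPrime p → n ≤ k + 2)) := by
  constructor
  · intro h W₀ _ _ q _ hc hoff
    exact (X2.cellB_lambdaCountSlack_iff hWu h310 hGZK hpar hc (hμ W₀ q hc hoff)).mpr (h W₀ q hc hoff)
  · intro h W₀ _ _ q _ hc hoff
    exact (X2.cellB_lambdaCountSlack_iff hWu h310 hGZK hpar hc (hμ W₀ q hc hoff)).mp (h W₀ q hc hoff)

/-! ## §2. X1 currency (crux 5, good anomalous Eisenstein `p > 2`, `r_an = 0`) -/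

/-- **The slack λ-count on the leaf X1 ∩ {r = 0} implies Mazur's main conjecture at the pair.** On
`X1.RankZero.Leaf W p` (class X1, `r_an = 0`) with the μ-part `MuPartAt W p`: if
`∃ n k, λ_an = n ∧ λ_alg ≥ k ∧ n ≤ k + 1` then `MazurMainConjecture W p` — the tree's route T on the
leaf with parity automatic (`X1.TamagawaSqueeze.Leaf.mazurMainConjecture_of_algebraicLambdaGE`:
`λ_an` even by `X1.ParitySqueeze.Leaf.even_of_analyticLambdaEq`, `λ(X)` even by Prop. 3.10 at corank
`0`), packaged for an existential datum. PUBLISHED inputs by name: Wuthrich Thm. 16 (`hW16`),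
Greenberg Prop. 3.10 (`h310`), modularity (`hmod`), Gross–Zagier–Kolyvagin (`hGZK`).
[cite: GreenbergLNM1716, Prop. 3.10, Cor. 5.6 (p. 136) and §5 p. 183] [cite: Wuthrich2014, Thm. 16 (p. 397)] -/
theorem X1.mazurMainConjecture_of_lambdaCountSlack (hW16 : Wuthrich2014.charIdeal_dvd_padicLFunction)
    (h310 : prop310_selmerCorank_mod_two_eq_lambdaInvariant)
    (hmod : nonempty_modularParametrizationData)
    (hGZK : rank_eq_analyticRank_of_analyticRank_le_one) (hL : X1.RankZero.Leaf W p)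
    (hμ : MuPartAt W p)
    (h : ∃ n k : ℕ, X1.ParitySqueeze.AnalyticLambdaEq W p n ∧ AlgebraicLambdaGE W p k ∧ n ≤ k + 1) :
    MazurMainConjecture W p := by
  obtain ⟨n, k, hlam, halg, hnk⟩ := h
  exact X1.TamagawaSqueeze.Leaf.mazurMainConjecture_of_algebraicLambdaGE hW16 h310 hmod hGZK hL hμ
    hlam halg hnk

/-- **Slack form ⟺ Mazur's main conjecture, on the leaf X1 ∩ {r = 0} with the μ-part.** Conversely
Mazur's main conjecture gives the REGISTERED conclusion with `n = k` (g0's X1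
`exists_lambdaCount_of_mazurMainConjecture`; the leaf is good ordinary, `X1.RankZero.Leaf.goodOrd`),
a fortiori the slack one. [cite: GreenbergLNM1716, Prop. 3.10] [cite: Wuthrich2014, Thm. 16 (p. 397)] -/
theorem X1.lambdaCountSlack_iff_mazurMainConjecture
    (hW16 : Wuthrich2014.charIdeal_dvd_padicLFunction)
    (h310 : prop310_selmerCorank_mod_two_eq_lambdaInvariant)
    (hmod : nonempty_modularParametrizationData)
    (hGZK : rank_eq_analyticRank_of_analyticRank_le_one) (hL : X1.RankZero.Leaf W p)
    (hμ : MuPartAt W p) :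
    (∃ n k : ℕ, X1.ParitySqueeze.AnalyticLambdaEq W p n ∧ AlgebraicLambdaGE W p k ∧ n ≤ k + 1) ↔
      MazurMainConjecture W p := by
  refine ⟨X1.mazurMainConjecture_of_lambdaCountSlack hW16 h310 hmod hGZK hL hμ, fun hMC ↦ ?_⟩
  obtain ⟨hgood, hord⟩ := hL.goodOrd
  obtain ⟨n, k, hlam, halg, hnk⟩ :=
    EisensteinPrimesX1AnalyticLambdaCalculus.exists_lambdaCount_of_mazurMainConjecture hmod hgood hord hMC
  exact ⟨n, k, hlam, halg, hnk.trans (Nat.le_succ k)⟩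

/-- **The registered X1 λ-count ⟺ its parity-slack form, on the leaf X1 ∩ {r = 0} with the μ-part**
(PUBLISHED inputs `hW16`, `h310`, `hmod`, `hGZK`):
`(∃ n k, λ_an = n ∧ λ_alg ≥ k ∧ n ≤ k + 1) ↔ (∃ n k, λ_an = n ∧ λ_alg ≥ k ∧ n ≤ k)` — both sides are
`MazurMainConjecture W p` (this file and g0's X1 `lambdaCount_iff_mazurMainConjecture`).
[cite: GreenbergLNM1716, Prop. 3.10, Cor. 5.6 (p. 136) and §5 p. 183] [cite: Wuthrich2014, Thm. 16 (p. 397)] -/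
theorem X1.lambdaCountSlack_iff_lambdaCount (hW16 : Wuthrich2014.charIdeal_dvd_padicLFunction)
    (h310 : prop310_selmerCorank_mod_two_eq_lambdaInvariant)
    (hmod : nonempty_modularParametrizationData)
    (hGZK : rank_eq_analyticRank_of_analyticRank_le_one) (hL : X1.RankZero.Leaf W p)
    (hμ : MuPartAt W p) :
    (∃ n k : ℕ, X1.ParitySqueeze.AnalyticLambdaEq W p n ∧ AlgebraicLambdaGE W p k ∧ n ≤ k + 1) ↔
      (∃ n k : ℕ, X1.ParitySqueeze.AnalyticLambdaEq W p n ∧ AlgebraicLambdaGE W p k ∧ n ≤ k) := by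
  have hX := isClassX1_of_classX1 hL.classX1
  rw [X1.lambdaCountSlack_iff_mazurMainConjecture hW16 h310 hmod hGZK hL hμ,
    EisensteinPrimesX1AnalyticLambdaCalculus.lambdaCount_iff_mazurMainConjecture hW16 hmod hX.two_ne
      hX.hasGoodReductionAtPrime hX.not_dvd_frobeniusTrace hX.not_hasIrreducibleModPGaloisRep hμ]

/-- **At the level of the registered stub signatures of `Lines/mudescent.lean` on crux 5: given
stub 4 of that skeleton (`X1.MuPart.AnalyticMuLE W₀ p 0` off the locus) and Wuthrich Thm. 16, the
λ-stub AS REGISTERED and IN SLACK FORM are interchangeable.** The μ-part at `W₀` comes from the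
analytic certificate by `X1.MuPart.muPartAt_of_analyticMuLE_zero` (exactly as in `MazurMCOnX1RankZero_of`);
the equivalence is pointwise (`X1.lambdaCountSlack_iff_lambdaCount`). Reshaping to the slack form adds
Greenberg's Prop. 3.10 (`h310`, PUBLISHED, cite-only) to the composition's inputs; `hGr`-free.
[cite: GreenbergLNM1716, Prop. 3.10 and §5 p. 183] [cite: Wuthrich2014, Thm. 16 (p. 397)] -/
theorem X1.stub_lambdaCount_iff_slack_of_stub_mu (hW16 : Wuthrich2014.charIdeal_dvd_padicLFunction)
    (h310 : prop310_selmerCorank_mod_two_eq_lambdaInvariant)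
    (hmod : nonempty_modularParametrizationData)
    (hGZK : rank_eq_analyticRank_of_analyticRank_le_one)
    (hμ : ∀ (W₀ : WeierstrassCurve ℚ) [W₀.IsElliptic] [W₀.IsGloballyMinimal] (p : ℕ) [Fact p.Prime],
      ClassX1 W₀ p → W₀.analyticRank = 0 → ¬ HasRamifiedOddLineAt W₀ p →
        X1.MuPart.AnalyticMuLE W₀ p 0) :
    (∀ (W₀ : WeierstrassCurve ℚ) [W₀.IsElliptic] [W₀.IsGloballyMinimal] (p : ℕ) [Fact p.Prime],
      ClassX1 W₀ p → W₀.analyticRank = 0 → ¬ HasRamifiedOddLineAt W₀ p →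
        ∃ n k : ℕ, X1.ParitySqueeze.AnalyticLambdaEq W₀ p n ∧
          X1.TamagawaSqueeze.AlgebraicLambdaGE W₀ p k ∧ n ≤ k) ↔
    (∀ (W₀ : WeierstrassCurve ℚ) [W₀.IsElliptic] [W₀.IsGloballyMinimal] (p : ℕ) [Fact p.Prime],
      ClassX1 W₀ p → W₀.analyticRank = 0 → ¬ HasRamifiedOddLineAt W₀ p →
        ∃ n k : ℕ, X1.ParitySqueeze.AnalyticLambdaEq W₀ p n ∧
          X1.TamagawaSqueeze.AlgebraicLambdaGE W₀ p k ∧ n ≤ k + 1) := by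
  have key : ∀ (W₀ : WeierstrassCurve ℚ) [W₀.IsElliptic] [W₀.IsGloballyMinimal] (q : ℕ) [Fact q.Prime],
      ClassX1 W₀ q → W₀.analyticRank = 0 → ¬ HasRamifiedOddLineAt W₀ q →
      ((∃ n k : ℕ, X1.ParitySqueeze.AnalyticLambdaEq W₀ q n ∧ AlgebraicLambdaGE W₀ q k ∧ n ≤ k + 1) ↔
        (∃ n k : ℕ, X1.ParitySqueeze.AnalyticLambdaEq W₀ q n ∧ AlgebraicLambdaGE W₀ q k ∧ n ≤ k)) := by
    intro W₀ _ _ q _ hX1 hr0 hoff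
    have hX := isClassX1_of_classX1 hX1
    have hL : X1.RankZero.Leaf W₀ q := ⟨hX1, hr0⟩
    exact X1.lambdaCountSlack_iff_lambdaCount hW16 h310 hmod hGZK hL
      (muPartAt_of_analyticMuLE_zero hW16 hX.two_ne hX.hasGoodReductionAtPrime hX.not_dvd_frobeniusTrace
        hX.not_hasIrreducibleModPGaloisRep (hμ W₀ q hX1 hr0 hoff))
  constructor
  · intro h W₀ _ _ q _ hX1 hr0 hoff
    exact (key W₀ q hX1 hr0 hoff).mpr (h W₀ q hX1 hr0 hoff)
  · intro h W₀ _ _ q _ hX1 hr0 hoff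
    exact (key W₀ q hX1 hr0 hoff).mp (h W₀ q hX1 hr0 hoff)

/-! ## §3. Bookkeeping at analytic rank `0`: at a pair with `μ_an = 0` the λ-count (either form) IS
Miller's `BSD(E,p)` — both currencies (appended by seat lam-a g2, second filing)

ERRATUM (numbers) to the module docstring above (first filing p472446). Its per-pair example reads
ky MEMO-4-K5 §3's «TamLB ≤ 4 INCLUDING the trivial zero, i.e. ≤ 3 forced zeros of char X against the 4
needed» at `103206a1 @ 3` as an ATTAINED Tamagawa budget of `3`. It is an upper estimate only. By the
planner's desk table (HOME/TARGET.md §1.2 ROUTING v1.6.4: `T₀(103206a1) = {167}`,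
`s_167 = 3^{v₃(167² − 1) − 1} = 1`, rational `3`-torsion so `δ = 1`, and the tree's Tamagawa-witness
budgets carry `p ∤ #E(ℚ)_tors`), NO positive layer-`0` Tamagawa count is available in the kernel at
that étale end today: the pair is CONSTRUCTION under BOTH forms of the stub (slack form: `λ_alg ≥ 3`
wanted, `0` certified), pending the `δ = 1` budget files of seat lam-b. What the slack form buys,
exactly: a pair with certified `(μ, Λ)_an = (0, Λ)` closes by route T as soon as SOME
`AlgebraicLambdaGE W₀ p k` with `k ≥ Λ − e − 1` (instead of `Λ − e`) is in the kernel; which A10 / A3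
cells that moves is decided by the budget files, not here.

THE BOOKKEEPING LEMMAS. On sub-cell X2b (resp. on the leaf X1 ∩ {r = 0}) Mazur's main conjecture
at the pair is EQUIVALENT to `BSDp W p` in the tree (`X2.cellB_mazurMainConjectureAt_iff_bsdp`,
b2b gen 3; `X1.RankZero.Leaf.mazurMainConjecture_iff_bsdp`), granted the PUBLISHED rank-`0` facts.
Composed with §1–§2 and g0's `lambdaCount_iff_mazurMainConjectureAt` /
`lambdaCount_iff_mazurMainConjecture`: AT A PAIR WITH `μ_an = 0` (resp. the μ-part), stub 4 —
registered or slack — ⟺ `BSDp W p`. Since `BSD(E,p)` is a ℚ-isogeny invariant at analytic rank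
`≤ 1` (`Rank1ResidualX1Isogeny.bsdp_iff_of_isIsogenous`, Cassels), every `BSDp` display the cell
lands on a crux-3 / crux-5 class (route G, double-twist `3`-descent displays, …) discharges stub 4
at that class's étale end given the étale end's μ-certificate, and conversely. -/

/-- **X2b, `μ_an = 0`: the REGISTERED λ-count at the pair ⟺ `BSD(E,p)`.** On `X2.CellB W p` with
`X2.AnalyticMuLE W p 0`: `(∃ n k, λ_an = n ∧ λ_alg ≥ k ∧ n ≤ k + e) ↔ BSDp W p` — g0's
`lambdaCount_iff_mazurMainConjectureAt` followed by the tree's `X2.cellB_mazurMainConjectureAt_iff_bsdp`.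
PUBLISHED inputs by name (all conjuncts of `EisensteinPrimes.PublishedInputs` or derived from them):
Wuthrich Thm. 16 (`hWu`), Stein–Wuthrich Thm. 6.1 split / non-split (`hJs`, `hJn`) and the canonical
multiplicative heights (`hHs`, `hHn`), Gross–Zagier–Kolyvagin (`hGZK`), entire `L`-function (`hmod`,
from the newform conjunct), modularity (`hpar`), Greenberg–Stevens (`hGS`).
[cite: Wuthrich2014, Thm. 16 (p. 397)] [cite: SteinWuthrich2013, Thm. 6.1 (p. 20)]
[cite: GreenbergLNM1716, §4 (PDF pp. 112–113)] -/
theorem X2.cellB_lambdaCount_iff_bsdp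
    (hWu : thm16_charIdeal_dvd_multiplicative_of_reducible)
    (hJs : SteinWuthrich2013.thm61_splitMultiplicative)
    (hJn : SteinWuthrich2013.thm61_nonsplitMultiplicative)
    (hHs : SteinWuthrich2013.exists_isSplitMultCanonical)
    (hHn : SteinWuthrich2013.exists_isMultCanonical)
    (hGZK : rank_eq_analyticRank_of_analyticRank_le_one) (hmod : hasEntireLFunction_rat)
    (hpar : nonempty_modularParametrizationData)
    (hGS : greenberg_stevens (W := W) (p := p)) (hc : X2.CellB W p) (hμ0 : X2.AnalyticMuLE W p 0) :
    (∃ n k : ℕ, X2.AnalyticLambdaEq W p n ∧ AlgebraicLambdaGE W p k ∧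
      (¬ W.HasSplitMultiplicativeReductionAtPrime p → n ≤ k) ∧
      (W.HasSplitMultiplicativeReductionAtPrime p → n ≤ k + 1)) ↔ BSDp W p := by
  rw [lambdaCount_iff_mazurMainConjectureAt hWu hpar hc.2.1.1 hc.2.1.2.2 hc.2.1.2.1 hμ0]
  exact X2.cellB_mazurMainConjectureAt_iff_bsdp hWu hJs hJn hHs hHn hGZK hmod hpar W p hGS hc

/-- **X2b, `μ_an = 0`: the SLACK λ-count at the pair ⟺ `BSD(E,p)`** (one more PUBLISHED input than
`X2.cellB_lambdaCount_iff_bsdp`: Greenberg's Prop. 3.10, `h310`).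
[cite: GreenbergLNM1716, Prop. 3.10 and §4 (PDF pp. 112–113)] [cite: Wuthrich2014, Thm. 16 (p. 397)] -/
theorem X2.cellB_lambdaCountSlack_iff_bsdp
    (hWu : thm16_charIdeal_dvd_multiplicative_of_reducible)
    (h310 : prop310_selmerCorank_mod_two_eq_lambdaInvariant)
    (hJs : SteinWuthrich2013.thm61_splitMultiplicative)
    (hJn : SteinWuthrich2013.thm61_nonsplitMultiplicative)
    (hHs : SteinWuthrich2013.exists_isSplitMultCanonical)
    (hHn : SteinWuthrich2013.exists_isMultCanonical)
    (hGZK : rank_eq_analyticRank_of_analyticRank_le_one) (hmod : hasEntireLFunction_rat)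
    (hpar : nonempty_modularParametrizationData)
    (hGS : greenberg_stevens (W := W) (p := p)) (hc : X2.CellB W p) (hμ0 : X2.AnalyticMuLE W p 0) :
    (∃ n k : ℕ, X2.AnalyticLambdaEq W p n ∧ AlgebraicLambdaGE W p k ∧
      (¬ W.HasSplitMultiplicativeReductionAtPrime p → n ≤ k + 1) ∧
      (W.HasSplitMultiplicativeReductionAtPrime p → n ≤ k + 2)) ↔ BSDp W p := by
  rw [X2.cellB_lambdaCountSlack_iff hWu h310 hGZK hpar hc hμ0]
  exact X2.cellB_lambdaCount_iff_bsdp hWu hJs hJn hHs hHn hGZK hmod hpar hGS hc hμ0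

/-- **X1 ∩ {r = 0}, μ-part: the REGISTERED λ-count at the pair ⟺ `BSD(E,p)`.** On
`X1.RankZero.Leaf W p` with `MuPartAt W p`: `(∃ n k, λ_an = n ∧ λ_alg ≥ k ∧ n ≤ k) ↔ BSDp W p` — g0's
X1 `lambdaCount_iff_mazurMainConjecture` followed by the tree's
`X1.RankZero.Leaf.mazurMainConjecture_iff_bsdp`. PUBLISHED inputs: Wuthrich Thm. 16 (`hW16`),
Greenberg Thm. 4.1 (`hGr`), modularity (`hmod`), Gross–Zagier–Kolyvagin (`hGZK`).
[cite: GreenbergLNM1716, Thm. 4.1 and §5 (closing examples)] [cite: Wuthrich2014, Thm. 16 (p. 397)] -/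
theorem X1.leaf_lambdaCount_iff_bsdp (hW16 : Wuthrich2014.charIdeal_dvd_padicLFunction)
    (hGr : greenberg_charValue_rankZero) (hmod : nonempty_modularParametrizationData)
    (hGZK : rank_eq_analyticRank_of_analyticRank_le_one) (hL : X1.RankZero.Leaf W p)
    (hμ : MuPartAt W p) :
    (∃ n k : ℕ, X1.ParitySqueeze.AnalyticLambdaEq W p n ∧ AlgebraicLambdaGE W p k ∧ n ≤ k) ↔
      BSDp W p := by
  have hX := isClassX1_of_classX1 hL.classX1
  rw [EisensteinPrimesX1AnalyticLambdaCalculus.lambdaCount_iff_mazurMainConjecture hW16 hmod hX.two_ne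
      hX.hasGoodReductionAtPrime hX.not_dvd_frobeniusTrace hX.not_hasIrreducibleModPGaloisRep hμ]
  exact X1.RankZero.Leaf.mazurMainConjecture_iff_bsdp hW16 hGr hmod hGZK hL

/-- **X1 ∩ {r = 0}, μ-part: the SLACK λ-count at the pair ⟺ `BSD(E,p)`** (one more PUBLISHED input:
Greenberg's Prop. 3.10, `h310`). [cite: GreenbergLNM1716, Prop. 3.10 and Thm. 4.1]
[cite: Wuthrich2014, Thm. 16 (p. 397)] -/
theorem X1.leaf_lambdaCountSlack_iff_bsdp (hW16 : Wuthrich2014.charIdeal_dvd_padicLFunction)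
    (h310 : prop310_selmerCorank_mod_two_eq_lambdaInvariant) (hGr : greenberg_charValue_rankZero)
    (hmod : nonempty_modularParametrizationData)
    (hGZK : rank_eq_analyticRank_of_analyticRank_le_one) (hL : X1.RankZero.Leaf W p)
    (hμ : MuPartAt W p) :
    (∃ n k : ℕ, X1.ParitySqueeze.AnalyticLambdaEq W p n ∧ AlgebraicLambdaGE W p k ∧ n ≤ k + 1) ↔
      BSDp W p := by
  rw [X1.lambdaCountSlack_iff_lambdaCount hW16 h310 hmod hGZK hL hμ]
  exact X1.leaf_lambdaCount_iff_bsdp hW16 hGr hmod hGZK hL hμ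

end Summit.BirchSwinnertonDyer.BirchSwinnertonDyer.Theorems.EisensteinPrimesLambdaCountParitySlack

end
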